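import Mathlib
import HarnessLib
import Summits.NavierStokesRegularity.NavierStokesRegularity.Theorems.PoloidalWindowDoorPoloidalWindowRigidityTimeHeightShearNormalForm
import Summits.NavierStokesRegularity.NavierStokesRegularity.Theorems.PoloidalWindowDoorPoloidalWindowRigidityConstantShearSlice
import Summits.NavierStokesRegularity.NavierStokesRegularity.Theorems.PoloidalWindowDoorPoloidalWindowRigidityClebsch

/-!
# Route `PoloidalWindowDoor`, item `LrcModEntire` (stmt-NavierStokesRegularity-20428) / crux `PoloidalWindowRigidity` (K2,
# stmt-19708) — THE LINEAR SLICE STRUCTURE OF THE TIME–HEIGHT STRATUM (TH): `∂₂²v₂ + μ(t, x₂) Δ_h v₂ = 0`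

Cell ns-regularity-ideate, seat ns-poloidal-K2-p3 gen 5 (lead of item 20428, skeleton `slope-split`: stubs
`stub_timeHeightShearGerm` (this file's customer) and `stub_lrcGeneric`; file landed `--supports stmt-NavierStokesRegularity-20428`
as a helper; it equally serves the K2 lead's v4 stub `stub_timeHeightShear` of 19708, taken by ns-poloidal-K2-p2 g4, whose census
TH-STEP2 §3(i) lists this structure as «unexploited»).

On the stratum (TH) the shear slope of a poloidal class profile is a function of time and height: by ns-poloidal-K2-p2 g4's
normal form (`…TimeHeightShearNormalForm.timeHeightShear_normalForm`, p-landed) EVERY horizontal plane `{y₂ = c}` of EVERY slice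
is either horizontally flat or proportional-shear with one slope `μ(s,c)`: `∂₂v_b = μ ∂_b v₂` on the plane (`b = 0,1`).
Differentiating `div v = 0` in the vertical direction and the plane identity ALONG THE PLANE (horizontal directions are tangent
to it; mixed partials of the smooth slice commute) gives, on every non-flat plane, the LINEAR second-order identity
`∂₂²v₂ = −μ(s,c)(∂₀²v₂ + ∂₁²v₂)` — K2P1-LOCAL-NOTES §1(e)'s T0 `Δ_hφ + (1+A_qq)∂₃²φ + A_qz = 0` read on (TH), where it is
linear in `θ = v₂`: `θ_zz + μ Δ_h θ = 0` (elliptic where `μ > 0`, hyperbolic in the height where `μ < 0`; horizontal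
Fourier modes `e^{iξ·x_h} Y(z)` obey `Y″ = μ(z)|ξ|² Y`).  This is ns-poloidal-K2-p2 g2's constant-slope `wave_identity`
(p506330) localised to one plane.

* `fderiv_apply_eq_of_eqOn_plane` — two functions differentiable at `x` that agree on the horizontal plane through `x` have
  the same derivative at `x` in every horizontal direction `e_b`, `b ≠ 2` (restriction to the line `x + ℝ e_b ⊆` plane);
* `plane_wave_identity` — generic: a `C²` divergence-free `u : ℝ³ → ℝ³` whose plane `{y₂ = c}` is proportional-shear with
  slope `μ` satisfies `∂₂²u₂(x) = −μ(∂₀²u₂ + ∂₁²u₂)(x)` at every point `x` of that plane;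
* `linearSlice_of_timeHeightShear` — CLASS: profile of the route's Type-I class + the local (TH) identity on a nonempty open
  `W` ⇒ for every `s < 0` and every height `c`, the plane is flat OR there is `μ` with BOTH the plane shear identity and
  the linear slice identity `∂₂²v₂ = −μ Δ_h v₂` on it.

WHAT THIS IS NOT: not a claim about Navier–Stokes regularity, not (TH) and not the stub — the kinematic (T0) half of the
(TH) normal form in the kernel (bears_on LADDER-NS N0 via items 20428 / 19708).
-/

noncomputable section

-- the summit and its single sub-problem share the name (CONVENTIONS §1), as in every Theorems file
set_option linter.dupNamespace false

namespace Summit.NavierStokesRegularity.NavierStokesRegularity.Theorems.PoloidalWindowDoorPoloidalWindowRigidityTimeHeightShearLinearSlice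

open Set Function Filter Topology Metric
open scoped RealInnerProductSpace InnerProductSpace ContDiff
open Literature.Analysis Literature.Analysis.FluidPDE
open Summit.NavierStokesRegularity.NavierStokesRegularity.Theorems.PoloidalWindowDoorPoloidalWindowRigidityConstantShearMeans
open Summit.NavierStokesRegularity.NavierStokesRegularity.Theorems.PoloidalWindowDoorPoloidalWindowRigidityConstantShearSlice
open Summit.NavierStokesRegularity.NavierStokesRegularity.Theorems.PoloidalWindowDoorPoloidalWindowRigidityTimeHeightShearNormalForm
open Summit.NavierStokesRegularity.NavierStokesRegularity.Theorems.PoloidalWindowDoorPoloidalWindowRigidityClebsch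

/-! ### Differentiating an identity that holds on one horizontal plane -/

/-- **Horizontal derivatives see only the plane.**  If `g₁, g₂ : ℝ³ → ℝ` are differentiable at `x` and agree on the
horizontal plane `{y | y₂ = x₂}` through `x`, then `D g₁(x) e_b = D g₂(x) e_b` for every horizontal direction `b ≠ 2`
(both equal the derivative at `0` of `s ↦ gᵢ(x + s e_b)`, and the line lies in the plane). -/
theorem fderiv_apply_eq_of_eqOn_plane {g₁ g₂ : EuclideanSpace ℝ (Fin 3) → ℝ} {x : EuclideanSpace ℝ (Fin 3)}
    (h₁ : DifferentiableAt ℝ g₁ x) (h₂ : DifferentiableAt ℝ g₂ x)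
    (heq : ∀ y : EuclideanSpace ℝ (Fin 3), y 2 = x 2 → g₁ y = g₂ y) {b : Fin 3} (hb : b ≠ 2) :
    fderiv ℝ g₁ x (EuclideanSpace.single b 1) = fderiv ℝ g₂ x (EuclideanSpace.single b 1) := by
  set e : EuclideanSpace ℝ (Fin 3) := EuclideanSpace.single b 1 with he
  have hγ : HasDerivAt (fun s : ℝ => x + s • e) e 0 := by
    simpa using ((hasDerivAt_id (0 : ℝ)).smul_const e).const_add x
  have hd₁ : HasDerivAt (fun s : ℝ => g₁ (x + s • e)) (fderiv ℝ g₁ x e) 0 :=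
    h₁.hasFDerivAt.comp_hasDerivAt_of_eq (0 : ℝ) hγ (by simp)
  have hd₂ : HasDerivAt (fun s : ℝ => g₂ (x + s • e)) (fderiv ℝ g₂ x e) 0 :=
    h₂.hasFDerivAt.comp_hasDerivAt_of_eq (0 : ℝ) hγ (by simp)
  have hline : (fun s : ℝ => g₁ (x + s • e)) = fun s : ℝ => g₂ (x + s • e) := by
    funext s
    apply heq
    have he2 : e 2 = 0 := by
      simp [he, hb.symm]
    simp [he2]
  rw [hline] at hd₁
  exact hd₁.unique hd₂

/-! ### The plane wave identity -/

/-- **THE PLANE WAVE IDENTITY (T0 on (TH)).**  Let `u : ℝ³ → ℝ³` be `C²` and divergence-free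
(`∂₀u₀ + ∂₁u₁ + ∂₂u₂ = 0` everywhere), and suppose the plane `{y₂ = c}` is proportional-shear with slope `μ`:
`∂₂u_b(y) = μ ∂_b u₂(y)` for all `y` with `y₂ = c`, `b = 0,1`.  Then at every point `x` of that plane
`∂₂²u₂(x) = −μ (∂₀²u₂(x) + ∂₁²u₂(x))`:  `∂₂²u₂ = ∂₂(−∂₀u₀ − ∂₁u₁) = −∂₀(∂₂u₀) − ∂₁(∂₂u₁) = −μ(∂₀²u₂ + ∂₁²u₂)`, the middle
step by symmetry of mixed partials, the last by differentiating the plane identity along the plane. -/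
theorem plane_wave_identity {u : EuclideanSpace ℝ (Fin 3) → EuclideanSpace ℝ (Fin 3)} {μ c : ℝ} (hu : ContDiff ℝ 2 u)
    (hdiv : ∀ x, fderiv ℝ u x (EuclideanSpace.single 0 (1 : ℝ)) 0 + fderiv ℝ u x (EuclideanSpace.single 1 (1 : ℝ)) 1 +
      fderiv ℝ u x (EuclideanSpace.single 2 (1 : ℝ)) 2 = 0)
    (hslope : ∀ y : EuclideanSpace ℝ (Fin 3), y 2 = c → ∀ b : Fin 3, b ≠ 2 →
      fderiv ℝ u y (EuclideanSpace.single 2 (1 : ℝ)) b = μ * fderiv ℝ u y (EuclideanSpace.single b (1 : ℝ)) 2)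
    {x : EuclideanSpace ℝ (Fin 3)} (hx : x 2 = c) :
    fderiv ℝ (fun y => fderiv ℝ (fun y' => u y' 2) y (EuclideanSpace.single 2 (1 : ℝ))) x
        (EuclideanSpace.single 2 (1 : ℝ)) =
      -μ * (fderiv ℝ (fun y => fderiv ℝ (fun y' => u y' 2) y (EuclideanSpace.single 0 (1 : ℝ))) x
          (EuclideanSpace.single 0 (1 : ℝ)) +
        fderiv ℝ (fun y => fderiv ℝ (fun y' => u y' 2) y (EuclideanSpace.single 1 (1 : ℝ))) x
          (EuclideanSpace.single 1 (1 : ℝ))) := by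
  have hud : Differentiable ℝ u := hu.differentiable (by norm_num)
  have hc : ∀ i : Fin 3, ContDiff ℝ 2 (fun y => u y i) := fun i => contDiff_coord hu i
  -- `∂₂u₂ = −(∂₀u₀ + ∂₁u₁)` as functions
  have hF : (fun y => fderiv ℝ (fun y' => u y' 2) y (EuclideanSpace.single 2 (1 : ℝ))) = fun y =>
      -(fderiv ℝ (fun y' => u y' 0) y (EuclideanSpace.single 0 (1 : ℝ)) +
        fderiv ℝ (fun y' => u y' 1) y (EuclideanSpace.single 1 (1 : ℝ))) := by
    funext y
    rw [fderiv_coord_apply (hud y) 2, fderiv_coord_apply (hud y) 0, fderiv_coord_apply (hud y) 1]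
    linarith [hdiv y]
  have hd1 : ∀ (i : Fin 3) (a : EuclideanSpace ℝ (Fin 3)) (y : EuclideanSpace ℝ (Fin 3)),
      DifferentiableAt ℝ (fun y' => fderiv ℝ (fun y'' => u y'' i) y' a) y := fun i a y =>
    ((((hc i).fderiv_right (m := 1) (by norm_num)).clm_apply contDiff_const).differentiable one_ne_zero) y
  -- the plane identities `∂₂u_b = μ ∂_b u₂` (`b = 0,1`) differentiated ALONG the plane
  have hS : ∀ b : Fin 3, b ≠ 2 →
      fderiv ℝ (fun y => fderiv ℝ (fun y' => u y' b) y (EuclideanSpace.single 2 (1 : ℝ))) x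
          (EuclideanSpace.single b (1 : ℝ)) =
        μ * fderiv ℝ (fun y => fderiv ℝ (fun y' => u y' 2) y (EuclideanSpace.single b (1 : ℝ))) x
          (EuclideanSpace.single b (1 : ℝ)) := by
    intro b hb
    have heq : ∀ y : EuclideanSpace ℝ (Fin 3), y 2 = x 2 →
        fderiv ℝ (fun y' => u y' b) y (EuclideanSpace.single 2 (1 : ℝ)) =
          μ * fderiv ℝ (fun y' => u y' 2) y (EuclideanSpace.single b (1 : ℝ)) := by
      intro y hy
      rw [fderiv_coord_apply (hud y) b, fderiv_coord_apply (hud y) 2, hslope y (hy.trans hx) b hb]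
    rw [fderiv_apply_eq_of_eqOn_plane (hd1 b _ x) ((hd1 2 _ x).const_mul μ) heq hb,
      fderiv_const_mul (hd1 2 _ x)]
    simp only [FunLike.coe_smul, Pi.smul_apply, smul_eq_mul]
  rw [hF, fderiv_fun_neg, neg_apply, fderiv_fun_add (hd1 0 _ x) (hd1 1 _ x)]
  simp only [_root_.add_apply]
  rw [fderiv_fderiv_symm (hc 0), fderiv_fderiv_symm (hc 1), hS 0 (by decide), hS 1 (by decide)]
  ring

/-! ### Class form -/

section Class

variable {C : ℝ} {v : ℝ → EuclideanSpace ℝ (Fin 3) → EuclideanSpace ℝ (Fin 3)}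

/-- **THE LINEAR SLICE STRUCTURE OF (TH), CLASS FORM.**  Let `v` be a profile of the route's Type-I class (Type-I rate,
continuous on the slab, unit-viscosity Oseen-mild, divergence-free slices) whose shear slope is a function of `(time, height)`
on some nonempty open space–time subset `W` of the backward slab (`∂₂v_b(z) = m(z.1, z.2 2) ∂_b v₂(z)` on `W`, `b = 0,1`).
Then for EVERY `s < 0` and EVERY height `c`: EITHER the plane `{y₂ = c}` of the slice `s` is horizontally flat
(`∂₀v₂ = ∂₁v₂ = 0` on it), OR there is ONE slope `μ` such that on the whole plane `∂₂v_b = μ ∂_b v₂` (`b = 0,1`) AND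
the vertical velocity satisfies the linear second-order identity `∂₂²v₂ = −μ (∂₀²v₂ + ∂₁²v₂)`. -/
theorem linearSlice_of_timeHeightShear (hrate : HasTypeITimeDecay C v)
    (hcont : ContinuousOn (uncurry v) (Iio (0 : ℝ) ×ˢ univ))
    (hmild : ∀ s t : ℝ, s < t → t < 0 → ∀ x,
      v t x = UnboundedOperators.heatExtension (v s) (t - s) x - oseenDuhamel 1 s v v t x)
    (hdiv : ∀ t < 0, VectorCalculus.IsDivFree (v t))
    {W : Set (ℝ × EuclideanSpace ℝ (Fin 3))} (hW : IsOpen W) (hWne : W.Nonempty) (hWs : W ⊆ Iio (0 : ℝ) ×ˢ univ)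
    {m : ℝ → ℝ → ℝ}
    (h : ∀ z ∈ W, ∀ b : Fin 3, b ≠ 2 →
      fderiv ℝ (v z.1) z.2 (EuclideanSpace.single 2 1) b =
        m z.1 (z.2 2) * fderiv ℝ (v z.1) z.2 (EuclideanSpace.single b 1) 2) :
    ∀ s < 0, ∀ c : ℝ,
      (∀ y : EuclideanSpace ℝ (Fin 3), y 2 = c →
          fderiv ℝ (v s) y (EuclideanSpace.single 0 1) 2 = 0 ∧ fderiv ℝ (v s) y (EuclideanSpace.single 1 1) 2 = 0) ∨
        ∃ μ : ℝ, (∀ y : EuclideanSpace ℝ (Fin 3), y 2 = c → ∀ b : Fin 3, b ≠ 2 →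
            fderiv ℝ (v s) y (EuclideanSpace.single 2 1) b = μ * fderiv ℝ (v s) y (EuclideanSpace.single b 1) 2) ∧
          ∀ x : EuclideanSpace ℝ (Fin 3), x 2 = c →
            fderiv ℝ (fun y => fderiv ℝ (fun y' => v s y' 2) y (EuclideanSpace.single 2 (1 : ℝ))) x
                (EuclideanSpace.single 2 (1 : ℝ)) =
              -μ * (fderiv ℝ (fun y => fderiv ℝ (fun y' => v s y' 2) y (EuclideanSpace.single 0 (1 : ℝ))) x
                  (EuclideanSpace.single 0 (1 : ℝ)) +
                fderiv ℝ (fun y => fderiv ℝ (fun y' => v s y' 2) y (EuclideanSpace.single 1 (1 : ℝ))) x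
                  (EuclideanSpace.single 1 (1 : ℝ))) := by
  intro s hs c
  rcases timeHeightShear_normalForm hrate hcont hmild hW hWne hWs h s hs c with hflat | ⟨μ, hμ⟩
  · exact Or.inl hflat
  · refine Or.inr ⟨μ, hμ, fun x hx => ?_⟩
    have hu : ContDiff ℝ 2 (v s) := (contDiff_slice hrate hcont hmild hs).of_le (by norm_cast)
    exact plane_wave_identity hu (fun x => div_coord (hdiv s hs) x) hμ hx

end Class

end Summit.NavierStokesRegularity.NavierStokesRegularity.Theorems.PoloidalWindowDoorPoloidalWindowRigidityTimeHeightShearLinearSlice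

end
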